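import Summits.RiemannHypothesis.RiemannHypothesis.Theorems.WindowTracePrime2.Negative.Modulation
import Summits.RiemannHypothesis.RiemannHypothesis.Theorems.WindowTracePrime2.Negative.FiniteFamilies
import Literature.NumberTheory.LFunctions.WeilExplicitArchTermProofs
import Literature.NumberTheory.LFunctions.KadiriGammaRemainder
import Literature.NumberTheory.LFunctions.RiemannSiegelStirling

/-!
# The archimedean term of `W(k_T)` and the local counting law (upper half)

Negative-side support for crux `SpectralTrace.WindowTracePrime2` (stmt-RiemannHypothesis-11196;
cdisprove seat refuter-cdisprove-stmt-RiemannHypothesis-11196-0).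

* `weilArchIntegral_modulate_conv` — for `k = φ ⋆ φ̃` the archimedean integral of `k_T` is the
  real integral `∫ |φ̂(1/2+i(τ−T))|² Re ψ(1/4+iτ/2) dτ`.
* `archIntegral_modulate_le` — it is `≤ (log(3+|T|)+12)·∫|φ̂|² + ∫|φ̂|² log(1+|u|)`
  (`|Re ψ(1/4+iτ/2)| ≤ log(3+|τ|)+12`, `KadiriGamma.abs_re_digamma_le`), whence
  `re_weilFunctional_modulate_le`: `Re W(k_T) ≤ (∫|φ̂|²/2π) log(3+|T|) + C(φ)`.
* `ncard_near_le` — **local counting law, upper half**: every real family realising the window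
  identity `Trace(A)` (`A > 0`, hypothesis kept INLINE) has `#{i : |γ_i − T| ≤ 1} ≤ C₁ log(3+|T|)
  + C₂` for all real `T`, with constants from ONE bump of radius `min(A/2, 1)` — uniform in the
  window (the estimate behind the route's `WindowCompactness`), via the shifted identity
  `hasSum_norm_sq_shift` and `re_weilMellin_bump_ge`.
-/

noncomputable section

open Complex Filter Set MeasureTheory
open scoped Real Topology ContDiff ArithmeticFunction.vonMangoldt

namespace Summit.RiemannHypothesis.RiemannHypothesis.Theorems.WindowTracePrime2.Negative

open Literature.NumberTheory.LFunctions

/-- On the critical line the transform of `k_T`, `k = φ ⋆ φ̃`, is the shifted squared modulus. -/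
theorem weilMellin_modulate_conv_half {φ : ℝ → ℂ} (hφ : IsWeilTest φ) (T τ : ℝ) :
    weilMellin ((fun t => weilConv φ (weilReflect φ) t * cexp (((-(T * t) : ℝ) : ℂ) * I))) (1 / 2 + τ * I) =
      ((‖weilMellin φ (1 / 2 + ((τ - T : ℝ) : ℂ) * I)‖ ^ 2 : ℝ) : ℂ) := by
  rw [weilMellin_modulate, show (1 / 2 : ℂ) + τ * I - T * I = 1 / 2 + ((τ - T : ℝ) : ℂ) * I by
    push_cast; ring, weilMellin_weilQuadratic_of_re_eq hφ (by simp), Complex.normSq_eq_norm_sq]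

/-- The archimedean integral of `k_T` as a real integral. -/
theorem weilArchIntegral_modulate_conv {φ : ℝ → ℂ} (hφ : IsWeilTest φ) (T : ℝ) :
    weilArchIntegral ((fun t => weilConv φ (weilReflect φ) t * cexp (((-(T * t) : ℝ) : ℂ) * I))) =
      ((∫ τ : ℝ, ‖weilMellin φ (1 / 2 + ((τ - T : ℝ) : ℂ) * I)‖ ^ 2 *
        (Complex.digamma (1 / 4 + τ / 2 * I)).re : ℝ) : ℂ) := by
  unfold weilArchIntegral
  rw [← integral_complex_ofReal]
  congr 1 with τ
  rw [weilMellin_modulate_conv_half hφ]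
  push_cast
  ring

/-- Crude growth of the digamma weight: `|Re ψ(1/4 + iτ/2)| ≤ log(3 + |τ|) + 12`. -/
theorem abs_re_digamma_quarter_le (τ : ℝ) :
    |(Complex.digamma (1 / 4 + τ / 2 * I)).re| ≤ Real.log (3 + |τ|) + 12 := by
  have h := KadiriGamma.abs_re_digamma_le τ
  have e : ((((1 / 2 : ℝ)) : ℂ) + τ * I) / 2 = 1 / 4 + τ / 2 * I := by push_cast; ring
  rwa [e] at h

/-- The digamma weight is continuous in `τ`. -/
theorem continuous_re_digamma_quarter :
    Continuous fun τ : ℝ => (Complex.digamma (1 / 4 + τ / 2 * I)).re := by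
  have h := continuous_re_digamma_vertical (σ := 1 / 4) (by norm_num)
  have h' : Continuous fun τ : ℝ => (Complex.digamma (((1 / 4 : ℝ) : ℂ) + ((τ / 2 : ℝ) : ℂ) * I)).re :=
    h.comp (continuous_id.div_const 2)
  refine h'.congr fun τ => ?_
  congr 2
  push_cast
  ring

/-- `log(3+|τ|) ≤ log(3+|T|) + log(1+|τ−T|)`. [folklore] -/
theorem log_three_add_abs_le (T τ : ℝ) :
    Real.log (3 + |τ|) ≤ Real.log (3 + |T|) + Real.log (1 + |τ - T|) := by
  rw [← Real.log_mul (by positivity) (by positivity)]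
  apply Real.log_le_log (by positivity)
  have h1 : |τ| ≤ |T| + |τ - T| := by
    have := abs_add_le T (τ - T)
    rwa [add_sub_cancel] at this
  nlinarith [abs_nonneg T, abs_nonneg (τ - T)]

/-- Integrability of `u ↦ |φ̂(1/2+iu)|² · L(u)` against any continuous weight of linear growth
(decay `|φ̂| ≤ D/(1+u²)²`, `integrable_mul_weilMellin_vertical_of_norm_le_linear`). -/
theorem integrable_norm_sq_weilMellin_mul {φ : ℝ → ℂ} (hφ : IsWeilTest φ) {L : ℝ → ℝ}
    (hL : Continuous L) {C : ℝ} (hC : ∀ u, |L u| ≤ C * (1 + |u|)) :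
    Integrable fun u : ℝ => ‖weilMellin φ (1 / 2 + (u : ℂ) * I)‖ ^ 2 * L u := by
  set B : ℝ := weilL1W 0 φ with hB
  have hB0 : 0 ≤ B := weilL1W_nonneg 0 φ
  have hbd : ∀ u : ℝ, ‖weilMellin φ (1 / 2 + (u : ℂ) * I)‖ ≤ B := fun u =>
    norm_weilMellin_le_weilL1W hφ.1.continuous hφ.2 (by simp)
  set F : ℝ → ℂ := fun u => (starRingEnd ℂ) (weilMellin φ (1 / 2 + (u : ℂ) * I)) * (L u : ℂ)
    with hF
  have hFc : Continuous F := by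
    have h1 : Continuous fun u : ℝ => weilMellin φ (1 / 2 + (u : ℂ) * I) :=
      (continuous_weilMellin hφ.1.continuous hφ.2).comp (by fun_prop)
    exact (Complex.continuous_conj.comp h1).mul (Complex.continuous_ofReal.comp hL)
  have hFb : ∀ u, ‖F u‖ ≤ (B * C) * (1 + |u|) := fun u => by
    rw [hF, norm_mul, Complex.norm_conj, Complex.norm_real, Real.norm_eq_abs]
    calc ‖weilMellin φ (1 / 2 + (u : ℂ) * I)‖ * |L u| ≤ B * (C * (1 + |u|)) :=
          mul_le_mul (hbd u) (hC u) (abs_nonneg _) hB0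
      _ = B * C * (1 + |u|) := by ring
  have hint := integrable_mul_weilMellin_vertical_of_norm_le_linear hφ (1 / 2) hFc hFb
  have hint' : Integrable fun u : ℝ => ((‖weilMellin φ (1 / 2 + (u : ℂ) * I)‖ ^ 2 * L u : ℝ) : ℂ) := by
    refine hint.congr (Eventually.of_forall fun u => ?_)
    simp only [hF]
    push_cast
    rw [mul_right_comm, Complex.conj_mul']
  refine hint'.re.congr (Eventually.of_forall fun u => ?_)
  simp only [RCLike.re_to_complex, Complex.ofReal_re]

/-- `sqMass ≥ 0`. [folklore] -/
theorem sqMass_nonneg (φ : ℝ → ℂ) : 0 ≤ (∫ u : ℝ, ‖weilMellin φ (1 / 2 + (u : ℂ) * I)‖ ^ 2) := integral_nonneg fun _ => by positivity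

/-- `sqLogMass ≥ 0`. [folklore] -/
theorem sqLogMass_nonneg (φ : ℝ → ℂ) :
    0 ≤ (∫ u : ℝ, ‖weilMellin φ (1 / 2 + (u : ℂ) * I)‖ ^ 2 * Real.log (1 + |u|)) :=
  integral_nonneg fun u => mul_nonneg (by positivity) (Real.log_nonneg (by linarith [abs_nonneg u]))

/-- `u ↦ log(1+|u|)` is continuous. [folklore] -/
theorem continuous_log_one_add_abs : Continuous fun u : ℝ => Real.log (1 + |u|) :=
  Continuous.log (by fun_prop) fun u => by positivity

/-- `log(1+|u|) ≤ 1 + |u|`. [folklore] -/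
theorem log_one_add_abs_le (u : ℝ) : |Real.log (1 + |u|)| ≤ 1 * (1 + |u|) := by
  have h0 : 0 ≤ Real.log (1 + |u|) := Real.log_nonneg (by linarith [abs_nonneg u])
  rw [abs_of_nonneg h0, one_mul]
  have := Real.log_le_sub_one_of_pos (by positivity : (0 : ℝ) < 1 + |u|)
  linarith [abs_nonneg u]

/-- **Upper bound for the archimedean integral of `k_T`**:
`∫ |φ̂(τ−T)|² Re ψ(1/4+iτ/2) dτ ≤ (log(3+|T|) + 12)·∫|φ̂|² + ∫|φ̂|² log(1+|u|)`. -/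
theorem archIntegral_modulate_le {φ : ℝ → ℂ} (hφ : IsWeilTest φ) (T : ℝ) :
    ∫ τ : ℝ, ‖weilMellin φ (1 / 2 + ((τ - T : ℝ) : ℂ) * I)‖ ^ 2 *
        (Complex.digamma (1 / 4 + τ / 2 * I)).re ≤
      (Real.log (3 + |T|) + 12) * (∫ u : ℝ, ‖weilMellin φ (1 / 2 + (u : ℂ) * I)‖ ^ 2) + (∫ u : ℝ, ‖weilMellin φ (1 / 2 + (u : ℂ) * I)‖ ^ 2 * Real.log (1 + |u|)) := by
  set F : ℝ → ℝ := fun u => ‖weilMellin φ (1 / 2 + (u : ℂ) * I)‖ ^ 2 with hF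
  have hFnn : ∀ u, 0 ≤ F u := fun u => by positivity
  -- integrability of the integrand (weight of logarithmic growth) via the modulated test
  have hmod : ∀ τ : ℝ, ‖weilMellin φ (1 / 2 + ((τ - T : ℝ) : ℂ) * I)‖ ^ 2 =
      ‖weilMellin ((fun t => φ t * cexp (((-(T * t) : ℝ) : ℂ) * I))) (1 / 2 + (τ : ℂ) * I)‖ ^ 2 := fun τ => by
    rw [weilMellin_modulate]
    congr 3
    push_cast
    ring
  have hI1 : Integrable fun τ : ℝ => ‖weilMellin φ (1 / 2 + ((τ - T : ℝ) : ℂ) * I)‖ ^ 2 *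
      (Complex.digamma (1 / 4 + τ / 2 * I)).re := by
    have h := integrable_norm_sq_weilMellin_mul (isWeilTest_modulate hφ T)
      continuous_re_digamma_quarter (C := 14) fun τ => by
        have h1 := abs_re_digamma_quarter_le τ
        have h2 : Real.log (3 + |τ|) ≤ 2 + |τ| := by
          have := Real.log_le_sub_one_of_pos (by positivity : (0 : ℝ) < 3 + |τ|)
          linarith
        nlinarith [abs_nonneg τ, abs_nonneg ((Complex.digamma (1 / 4 + τ / 2 * I)).re)]
    exact h.congr (Eventually.of_forall fun τ => by simp only [hmod])
  -- the majorant `F(τ - T)(c_T + log(1 + |τ - T|))`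
  set cT : ℝ := Real.log (3 + |T|) + 12 with hcT
  have hG : Integrable fun u : ℝ => F u * (cT + Real.log (1 + |u|)) := by
    have h := integrable_norm_sq_weilMellin_mul hφ (L := fun u => cT + Real.log (1 + |u|))
      (continuous_const.add continuous_log_one_add_abs) (C := |cT| + 1) fun u => by
        have h1 := log_one_add_abs_le u
        have h0 : 0 ≤ Real.log (1 + |u|) := Real.log_nonneg (by linarith [abs_nonneg u])
        calc |cT + Real.log (1 + |u|)| ≤ |cT| + |Real.log (1 + |u|)| := abs_add_le _ _
          _ ≤ |cT| * (1 + |u|) + 1 * (1 + |u|) := by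
              nlinarith [abs_nonneg cT, abs_nonneg u]
          _ = (|cT| + 1) * (1 + |u|) := by ring
    exact h
  have hI2 : Integrable fun τ : ℝ => F (τ - T) * (cT + Real.log (1 + |τ - T|)) :=
    hG.comp_sub_right T
  -- pointwise comparison
  have hle : ∀ τ : ℝ, ‖weilMellin φ (1 / 2 + ((τ - T : ℝ) : ℂ) * I)‖ ^ 2 *
      (Complex.digamma (1 / 4 + τ / 2 * I)).re ≤ F (τ - T) * (cT + Real.log (1 + |τ - T|)) := by
    intro τ
    have hFeq : ‖weilMellin φ (1 / 2 + ((τ - T : ℝ) : ℂ) * I)‖ ^ 2 = F (τ - T) := by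
      simp only [hF]
    rw [hFeq]
    refine mul_le_mul_of_nonneg_left ?_ (hFnn _)
    have h1 := (le_abs_self _).trans (abs_re_digamma_quarter_le τ)
    have h2 := log_three_add_abs_le T τ
    linarith
  calc ∫ τ : ℝ, ‖weilMellin φ (1 / 2 + ((τ - T : ℝ) : ℂ) * I)‖ ^ 2 *
          (Complex.digamma (1 / 4 + τ / 2 * I)).re
      ≤ ∫ τ : ℝ, F (τ - T) * (cT + Real.log (1 + |τ - T|)) := integral_mono hI1 hI2 hle
    _ = ∫ u : ℝ, F u * (cT + Real.log (1 + |u|)) :=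
        integral_sub_right_eq_self (fun u => F u * (cT + Real.log (1 + |u|))) T
    _ = cT * (∫ u : ℝ, ‖weilMellin φ (1 / 2 + (u : ℂ) * I)‖ ^ 2) + (∫ u : ℝ, ‖weilMellin φ (1 / 2 + (u : ℂ) * I)‖ ^ 2 * Real.log (1 + |u|)) := by
        have hF1 : Integrable fun u : ℝ => F u * cT := by
          have h := integrable_norm_sq_weilMellin_mul hφ (L := fun _ => cT) continuous_const
            (C := |cT|) fun u => by nlinarith [abs_nonneg cT, abs_nonneg u]
          exact h
        have hF2 : Integrable fun u : ℝ => F u * Real.log (1 + |u|) :=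
          integrable_norm_sq_weilMellin_mul hφ continuous_log_one_add_abs log_one_add_abs_le
        simp_rw [mul_add]
        rw [integral_add hF1 hF2, ← integral_const_mul]
        congr 1
        refine integral_congr_ae (Eventually.of_forall fun u => ?_)
        simp only [hF]
        ring

/-- **Upper bound for `Re W(k_T)`**, `k = φ ⋆ φ̃`: logarithmic in `T` with explicit constants. -/
theorem re_weilFunctional_modulate_le {φ : ℝ → ℂ} (hφ : IsWeilTest φ) (T : ℝ) :
    (weilFunctional ((fun t => weilConv φ (weilReflect φ) t * cexp (((-(T * t) : ℝ) : ℂ) * I)))).re ≤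
      (∫ u : ℝ, ‖weilMellin φ (1 / 2 + (u : ℂ) * I)‖ ^ 2) / (2 * π) * Real.log (3 + |T|) +
        (2 * weilL1W (1 / 2) (weilConv φ (weilReflect φ)) +
          (∑' n : ℕ, ‖((Λ n : ℝ) : ℂ) / (Real.sqrt n : ℂ)‖ * (‖weilConv φ (weilReflect φ) (Real.log n)‖ + ‖weilConv φ (weilReflect φ) (-Real.log n)‖)) +
          (12 * (∫ u : ℝ, ‖weilMellin φ (1 / 2 + (u : ℂ) * I)‖ ^ 2) + (∫ u : ℝ, ‖weilMellin φ (1 / 2 + (u : ℂ) * I)‖ ^ 2 * Real.log (1 + |u|))) / (2 * π) +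
          ‖weilConv φ (weilReflect φ) 0‖ * Real.log π) := by
  set k := weilConv φ (weilReflect φ) with hk_def
  have hk : IsWeilTest k := hφ.weilConv hφ.weilReflect
  have hpol := norm_weilPolarTerm_modulate_le hk T
  have hpri := norm_weilPrimeTerm_modulate_le hk.2 T
  have harch := archIntegral_modulate_le hφ T
  -- real part of the archimedean term
  have hre_arch : (weilArchTerm ((fun t => k t * cexp (((-(T * t) : ℝ) : ℂ) * I)))).re =
      (1 / (2 * π)) * (∫ τ : ℝ, ‖weilMellin φ (1 / 2 + ((τ - T : ℝ) : ℂ) * I)‖ ^ 2 *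
        (Complex.digamma (1 / 4 + τ / 2 * I)).re) - (k 0).re * Real.log π := by
    rw [weilArchTerm, hk_def, weilArchIntegral_modulate_conv hφ T]
    simp only [modChar_zero, mul_one]
    rw [← hk_def]
    have e1 : (1 / (2 * π) : ℂ) = ((1 / (2 * π) : ℝ) : ℂ) := by push_cast; ring
    rw [e1, Complex.sub_re, Complex.re_ofReal_mul, Complex.ofReal_re]
    congr 1
    rw [Complex.mul_re, Complex.ofReal_re, Complex.ofReal_im, mul_zero, sub_zero]
  have hk0 : -((k 0).re * Real.log π) ≤ ‖k 0‖ * Real.log π := by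
    have h1 : |(k 0).re| ≤ ‖k 0‖ := Complex.abs_re_le_norm _
    have h2 : 0 < Real.log π := Real.log_pos (by linarith [Real.pi_gt_three])
    nlinarith [neg_abs_le (k 0).re]
  have hW : (weilFunctional ((fun t => k t * cexp (((-(T * t) : ℝ) : ℂ) * I)))).re =
      (weilPolarTerm ((fun t => k t * cexp (((-(T * t) : ℝ) : ℂ) * I)))).re - (weilPrimeTerm ((fun t => k t * cexp (((-(T * t) : ℝ) : ℂ) * I)))).re +
        (weilArchTerm ((fun t => k t * cexp (((-(T * t) : ℝ) : ℂ) * I)))).re := by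
    simp [weilFunctional]
  rw [hW, hre_arch]
  have h1 : (weilPolarTerm ((fun t => k t * cexp (((-(T * t) : ℝ) : ℂ) * I)))).re ≤ 2 * weilL1W (1 / 2) k :=
    (Complex.re_le_norm _).trans hpol
  have h2 : -(weilPrimeTerm ((fun t => k t * cexp (((-(T * t) : ℝ) : ℂ) * I)))).re ≤ (∑' n : ℕ, ‖((Λ n : ℝ) : ℂ) / (Real.sqrt n : ℂ)‖ * (‖k (Real.log n)‖ + ‖k (-Real.log n)‖)) := by
    have := Complex.abs_re_le_norm (weilPrimeTerm ((fun t => k t * cexp (((-(T * t) : ℝ) : ℂ) * I))))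
    linarith [neg_abs_le (weilPrimeTerm ((fun t => k t * cexp (((-(T * t) : ℝ) : ℂ) * I)))).re]
  have hπ : 0 < 1 / (2 * π) := by positivity
  have h3 := mul_le_mul_of_nonneg_left harch hπ.le
  set M₀ : ℝ := (∫ u : ℝ, ‖weilMellin φ (1 / 2 + (u : ℂ) * I)‖ ^ 2) with hM₀
  set M₁ : ℝ := (∫ u : ℝ, ‖weilMellin φ (1 / 2 + (u : ℂ) * I)‖ ^ 2 * Real.log (1 + |u|)) with hM₁
  have e : 1 / (2 * π) * ((Real.log (3 + |T|) + 12) * M₀ + M₁) =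
      M₀ / (2 * π) * Real.log (3 + |T|) + (12 * M₀ + M₁) / (2 * π) := by
    field_simp
    ring
  rw [e] at h3
  linarith

/-! ### Local counting bound for every witness (uniform in the window) -/

/-- **Local counting law, upper half.** If `γ` realises `Trace A` (`A > 0`) then
`#{i : |γ_i − T| ≤ 1} ≤ C₁ log(3 + |T|) + C₂` for every real `T`; the constants depend only on
a bump of radius `min(A/2, 1)`, so they serve every larger window too (this is the uniform
estimate the route's `WindowCompactness` needs, and the upper half of the Weyl law
`N(T) = O(T log T)` for witnesses). -/
theorem ncard_near_le {A : ℝ} (hA : 0 < A) {ι : Type} {γ : ι → ℝ}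
    (h : (∀ g : ℝ → ℂ, IsWeilTest g → tsupport g ⊆ Set.Icc (-A) A →
        HasSum (fun i => weilMellin g (1 / 2 + (γ i : ℂ) * Complex.I)) (weilFunctional g))) :
    ∃ C₁ C₂ : ℝ, ∀ T : ℝ,
      ({i : ι | |γ i - T| ≤ 1}.ncard : ℝ) ≤ C₁ * Real.log (3 + |T|) + C₂ := by
  -- a bump of radius `a = min (A/2) 1`
  set a : ℝ := min (A / 2) 1 with ha_def
  have ha : 0 < a := lt_min (by linarith) one_pos
  have haA : 2 * a ≤ A := by have := min_le_left (A / 2) 1; linarith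
  have ha1 : a ≤ 1 := min_le_right _ _
  let b : ContDiffBump (0 : ℝ) := ⟨a / 2, a, by positivity, by linarith⟩
  set φ : ℝ → ℂ := fun t => ((b t : ℝ) : ℂ) with hφ_def
  have hφ : IsWeilTest φ :=
    ⟨Complex.ofRealCLM.contDiff.comp b.contDiff, b.hasCompactSupport.comp_left Complex.ofReal_zero⟩
  have hφs : tsupport φ ⊆ Set.Icc (-a) a := by
    refine (tsupport_comp_subset Complex.ofReal_zero _).trans ?_
    rw [b.tsupport_eq, Real.closedBall_eq_Icc, zero_sub, zero_add]
  set c₀ : ℝ := Real.cos 1 * ∫ t, b t with hc₀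
  have hcos : 0 < Real.cos 1 := Real.cos_pos_of_mem_Ioo ⟨by linarith [Real.pi_gt_three],
    by linarith [Real.pi_gt_three]⟩
  have hc₀pos : 0 < c₀ := mul_pos hcos b.integral_pos
  -- the constants
  set k := weilConv φ (weilReflect φ) with hk_def
  set C₁ : ℝ := (∫ u : ℝ, ‖weilMellin φ (1 / 2 + (u : ℂ) * I)‖ ^ 2) / (2 * π) with hC₁
  set C₂ : ℝ := 2 * weilL1W (1 / 2) k + (∑' n : ℕ, ‖((Λ n : ℝ) : ℂ) / (Real.sqrt n : ℂ)‖ * (‖k (Real.log n)‖ + ‖k (-Real.log n)‖)) + (12 * (∫ u : ℝ, ‖weilMellin φ (1 / 2 + (u : ℂ) * I)‖ ^ 2) + (∫ u : ℝ, ‖weilMellin φ (1 / 2 + (u : ℂ) * I)‖ ^ 2 * Real.log (1 + |u|))) / (2 * π) +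
    ‖k 0‖ * Real.log π with hC₂
  refine ⟨C₁ / c₀ ^ 2, C₂ / c₀ ^ 2, fun T => ?_⟩
  have hS := hasSum_norm_sq_shift h hφ hφs haA T
  have hW := re_weilFunctional_modulate_le hφ T
  -- the near atoms form a finite set
  have hfin : {i : ι | |γ i - T| ≤ 1}.Finite := by
    refine (finite_abs_le_of_trace hA h (|T| + 1)).subset ?_
    intro i hi
    simp only [Set.mem_setOf_eq] at hi ⊢
    have := abs_add_le (γ i - T) T
    rw [sub_add_cancel] at this
    linarith
  -- each near atom contributes at least `c₀²`
  have hnear : ∀ i ∈ hfin.toFinset, c₀ ^ 2 ≤ ‖weilMellin φ (1 / 2 + ((γ i - T : ℝ) : ℂ) * I)‖ ^ 2 := by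
    intro i hi
    rw [Set.Finite.mem_toFinset, Set.mem_setOf_eq] at hi
    have hγ : |γ i - T| * b.rOut ≤ 1 := by
      calc |γ i - T| * b.rOut ≤ 1 * 1 := mul_le_mul hi ha1 b.rOut_pos.le zero_le_one
        _ = 1 := one_mul 1
    have hre := re_weilMellin_bump_ge b hγ
    have hn : c₀ ≤ ‖weilMellin φ (1 / 2 + ((γ i - T : ℝ) : ℂ) * I)‖ :=
      hre.trans (Complex.re_le_norm _)
    nlinarith
  have hsum : ∑ i ∈ hfin.toFinset, ‖weilMellin φ (1 / 2 + ((γ i - T : ℝ) : ℂ) * I)‖ ^ 2 ≤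
      (weilFunctional ((fun t => k t * cexp (((-(T * t) : ℝ) : ℂ) * I)))).re :=
    sum_le_hasSum _ (fun i _ => by positivity) hS
  have hcard : c₀ ^ 2 * (hfin.toFinset.card : ℝ) ≤
      ∑ i ∈ hfin.toFinset, ‖weilMellin φ (1 / 2 + ((γ i - T : ℝ) : ℂ) * I)‖ ^ 2 := by
    have := Finset.card_nsmul_le_sum hfin.toFinset _ (c₀ ^ 2) hnear
    rw [nsmul_eq_mul] at this
    linarith
  rw [Set.ncard_eq_toFinset_card _ hfin]
  have hc2 : 0 < c₀ ^ 2 := by positivity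
  rw [div_mul_eq_mul_div, ← add_div, le_div_iff₀ hc2]
  calc (hfin.toFinset.card : ℝ) * c₀ ^ 2 = c₀ ^ 2 * hfin.toFinset.card := by ring
    _ ≤ (weilFunctional ((fun t => k t * cexp (((-(T * t) : ℝ) : ℂ) * I)))).re := hcard.trans hsum
    _ ≤ C₁ * Real.log (3 + |T|) + C₂ := by rw [hC₁, hC₂, hk_def]; exact hW

end Summit.RiemannHypothesis.RiemannHypothesis.Theorems.WindowTracePrime2.Negative

end
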